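import Summits.BirchSwinnertonDyer.BirchSwinnertonDyer.Theorems.SignedBaseChangeTwistPairGreenbergProductDivisibilityStubFrameData
import HarnessLib

/-!
# Big image survives small base change: `ρ̄_{E,p}` onto `GL₂(𝔽_p)` and `[M:ℚ] < p` ⟹ every
# `𝔽_p`-framing of `E[p]|_{Γ_M}` is absolutely irreducible (lemma (L1) `BigImageSmallBaseChange` of the
# crux-idea card `definite-bf-transplant` on K1′ `TwistPairGreenbergProductDivisibilitySplit`,
# stmt-BirchSwinnertonDyer-20502; helper file, lead sbc-p1 g3)

The base-change line behind K1′ (Burungale–Castella–Skinner 2025 Prop. 5.2.1 transplanted to a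
supersingular `p`; planner memo `K1PRIME-LINE-MEMO-v1.md` §5 (L1), `Sketch7.lean`) needs the residual
irreducibility hypotheses (irr_K) for the imaginary quadratic `K`, and (irr_M) for the CM biquadratic
`M = F·K` (`F = ℚ(√d)` real quadratic) — BCS25 Prop. 5.2.1 (iv) — for EVERY frame, with no Chebotarev
avoidance. The tree had the quadratic case (`SignedBaseChangeK1FrameData.irrK_framed_of_surj`: one
transvection and index `2`, which is normal). This file proves the general small-index statement:

* `isAbsolutelyIrreducible_of_transvections` (linear algebra, any field `A`, any group): a rank-2 framed
  representation whose image contains two transvections with DIFFERENT fixed lines (witnessed by a vector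
  killed by the first nilpotent and not by the second) is absolutely irreducible — over any `B ⊇ A` a
  stable line would be the fixed line of both (`Transvection.toSubmodule_eq_ker_of_transvection`).
* `exists_eq_of_surj`: under (sur) every element of `GL₂(𝔽_p)` is `ρ̄(σ)` for some `σ ∈ Γ_ℚ` (in any
  framing of `E[p]`); in particular the upper and the lower elementary unipotents.
* `isAbsolutelyIrreducible_comp_of_surj_of_finrank_lt`: if `[M:ℚ] < p`, then for `σ` with `ρ̄(σ)`
  the upper (resp. lower) unipotent some power `σ^k`, `1 ≤ k ≤ [M:ℚ] < p`, lies in the image of `Γ_M`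
  (pigeonhole on cosets, `Subgroup.exists_pow_mem_of_index_ne_zero`; the index of `Γ_M` in `Γ_ℚ` is
  `[M:ℚ]`, `Automorphic.isOpen_range_absGaloisRestrict_and_index`), and `ρ̄(σ)^k` is again a non-trivial
  upper (resp. lower) unipotent since `k ≢ 0 (mod p)`; the two have different fixed lines.
* `irrM_framed_of_surj`: transport to an arbitrary framing of `E_M[p]` (as in `irrK_framed_of_surj`).
* `bigImageSmallBaseChange`: the planner's (L1) verbatim — `5 ≤ p`, `Surj W p`, `[M:ℚ] ≤ 4`.

Group theory only (Serre 1972 §2.8-style transvection arguments); no named fact, no new definition.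
-/

-- D-0017: single-problem summit, the namespace repeats the problem name by design.
set_option linter.dupNamespace false
set_option autoImplicit false

noncomputable section

open scoped Classical MatrixGroups Matrix

namespace Summit.BirchSwinnertonDyer.BirchSwinnertonDyer.Theorems.SignedBaseChangeK1BigImage

open NumberField Field WeierstrassCurve
open Literature Literature.NumberTheory.EllipticCurves Literature.NumberTheory.GaloisRepresentations
open Summit.BirchSwinnertonDyer.Rank1Residual.X11b.Transvection
open Summit.BirchSwinnertonDyer.BirchSwinnertonDyer.Theorems.SignedBaseChangeK1FrameData

universe u

/-! ## §1. Two transvections with different fixed lines ⟹ absolutely irreducible -/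

section Framed

variable {H : Type*} [Group H] [TopologicalSpace H] {A : Type u} [Field A] [TopologicalSpace A]

/-- **Two transvections with different fixed lines force absolute irreducibility** (rank `2`, any
field). If `π(h₁)`, `π(h₂)` are transvections (`≠ 1`, `(π(hᵢ) − 1)² = 0`) and some vector `v` is killed
by `π(h₁) − 1` but not by `π(h₂) − 1`, then `π` is absolutely irreducible: over any field `B ⊇ A` a
stable line would equal `ker(π(h₁) − 1)_B` and `ker(π(h₂) − 1)_B`, which differ at `v`. [folklore] -/
theorem isAbsolutelyIrreducible_of_transvections (π : FramedRep H A 2) (h₁ h₂ : H)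
    (hne₁ : ((π h₁ : GL (Fin 2) A) : Matrix (Fin 2) (Fin 2) A) ≠ 1)
    (hsq₁ : (((π h₁ : GL (Fin 2) A) : Matrix (Fin 2) (Fin 2) A) - 1) *
      (((π h₁ : GL (Fin 2) A) : Matrix (Fin 2) (Fin 2) A) - 1) = 0)
    (hne₂ : ((π h₂ : GL (Fin 2) A) : Matrix (Fin 2) (Fin 2) A) ≠ 1)
    (hsq₂ : (((π h₂ : GL (Fin 2) A) : Matrix (Fin 2) (Fin 2) A) - 1) *
      (((π h₂ : GL (Fin 2) A) : Matrix (Fin 2) (Fin 2) A) - 1) = 0)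
    (v : Fin 2 → A)
    (hv₁ : (((π h₁ : GL (Fin 2) A) : Matrix (Fin 2) (Fin 2) A) - 1).mulVec v = 0)
    (hv₂ : (((π h₂ : GL (Fin 2) A) : Matrix (Fin 2) (Fin 2) A) - 1).mulVec v ≠ 0) :
    π.IsAbsolutelyIrreducible := by
  intro B _ f
  classical
  obtain ⟨N₁, hπ₁, hN₁, hN₁sq, hN₁v⟩ := exists_transvection_baseChange π h₁ hne₁ hsq₁ B f
  obtain ⟨N₂, hπ₂, hN₂, hN₂sq, hN₂v⟩ := exists_transvection_baseChange π h₂ hne₂ hsq₂ B f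
  set ϖ := π.baseChangeRepresentation f with hϖdef
  have h2 : Module.finrank B (Fin 2 → B) = 2 := by simp
  have hVbt : (⊥ : Submodule B (Fin 2 → B)) ≠ ⊤ := by
    intro h
    have : (fun _ => (1 : B)) ∈ (⊥ : Submodule B (Fin 2 → B)) := by rw [h]; trivial
    rw [Submodule.mem_bot] at this
    exact one_ne_zero (congrFun this 0)
  haveI : Nontrivial (Subrepresentation ϖ) :=
    ⟨⟨⊥, ⊤, fun h => hVbt (congrArg Subrepresentation.toSubmodule h)⟩⟩
  refine ⟨fun W => ?_⟩
  by_contra hW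
  obtain ⟨hWb, hWt⟩ := not_or.mp hW
  have hW₁ : W.toSubmodule = LinearMap.ker N₁ :=
    toSubmodule_eq_ker_of_transvection ϖ h2 hπ₁ hN₁ hN₁sq W hWb hWt
  have hW₂ : W.toSubmodule = LinearMap.ker N₂ :=
    toSubmodule_eq_ker_of_transvection ϖ h2 hπ₂ hN₂ hN₂sq W hWb hWt
  -- `f ∘ v` lies in `ker N₁ = W = ker N₂`, but `N₂ (f ∘ v) = f ∘ ((π h₂ − 1) v) ≠ 0`
  have hmem : (f ∘ v) ∈ W.toSubmodule := by
    rw [hW₁, LinearMap.mem_ker, hN₁v v, hv₁]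
    exact funext fun _ => map_zero f
  rw [hW₂, LinearMap.mem_ker, hN₂v v] at hmem
  apply hv₂
  funext i
  have hi := congrFun hmem i
  simp only [Function.comp_apply, Pi.zero_apply] at hi
  exact (map_eq_zero_iff f f.injective).mp hi

end Framed

/-! ## §2. Surjectivity realises every element of `GL₂(𝔽_p)`; powers of the elementary unipotents -/

section Surj

variable (W : WeierstrassCurve ℚ) (p : ℕ) [Fact p.Prime]

/-- **Under (sur), every `T ∈ GL₂(𝔽_p)` is `ρ̄(σ)` for some `σ ∈ Γ_ℚ`**, in any framing `ρ̄` of `E[p]`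
(the automorphism `e⁻¹ ∘ T ∘ e` of `E[p]` is realised by Galois). [folklore] -/
theorem exists_eq_of_surj (hsurj : W.HasSurjectiveModNGaloisRep (p : ℤ))
    {ρ : ModPGaloisRep ℚ (ZMod p) 2} (hρ : W.IsTorsionGaloisRep p ρ) (T : GL (Fin 2) (ZMod p)) :
    ∃ σ : absoluteGaloisGroup ℚ,
      ((ρ σ : GL (Fin 2) (ZMod p)) : Matrix (Fin 2) (Fin 2) (ZMod p)) = T := by
  obtain ⟨e, he⟩ := hρ
  -- `v ↦ T v` as an additive automorphism of `𝔽_p²`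
  let τ : (Fin 2 → ZMod p) ≃+ (Fin 2 → ZMod p) :=
    { toFun := fun v ↦ (T : Matrix (Fin 2) (Fin 2) (ZMod p)) *ᵥ v
      invFun := fun v ↦ ((T⁻¹ : GL (Fin 2) (ZMod p)) : Matrix (Fin 2) (Fin 2) (ZMod p)) *ᵥ v
      left_inv := fun v ↦ by
        simp only [Matrix.mulVec_mulVec, ← Units.val_mul, inv_mul_cancel, Units.val_one, Matrix.one_mulVec]
      right_inv := fun v ↦ by
        simp only [Matrix.mulVec_mulVec, ← Units.val_mul, mul_inv_cancel, Units.val_one, Matrix.one_mulVec]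
      map_add' := fun v w ↦ Matrix.mulVec_add _ v w }
  have hτ : ∀ v, τ v = (T : Matrix (Fin 2) (Fin 2) (ZMod p)) *ᵥ v := fun _ ↦ rfl
  let φ : geomTorsion W (p : ℤ) ≃+ geomTorsion W (p : ℤ) := (e.trans τ).trans e.symm
  obtain ⟨σ, hσ⟩ := hsurj (Multiplicative.ofAdd φ)
  have hσ' : ∀ P : geomTorsion W (p : ℤ), σ • P = φ P := fun P ↦ by
    have h := congrArg (fun f ↦ (Multiplicative.toAdd f) P) hσ
    simpa only [galoisRepTorsion_apply, toAdd_ofAdd] using h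
  refine ⟨σ, Matrix.toLin'.injective (LinearMap.ext fun w ↦ ?_)⟩
  simp only [Matrix.toLin'_apply]
  obtain ⟨P, rfl⟩ := e.surjective w
  rw [← he σ P, hσ' P]
  change e ((e.trans τ |>.trans e.symm) P) = _
  rw [AddEquiv.trans_apply, AddEquiv.trans_apply, AddEquiv.apply_symm_apply, hτ]

/-- The upper elementary unipotent `(1 1; 0 1) ∈ GL₂(𝔽_p)`. [folklore] -/
theorem exists_upper : ∃ U : GL (Fin 2) (ZMod p), (U : Matrix (Fin 2) (Fin 2) (ZMod p)) = !![1, 1; 0, 1] :=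
  ⟨⟨!![1, 1; 0, 1], !![1, -1; 0, 1],
      by ext i j; fin_cases i <;> fin_cases j <;> simp [Matrix.mul_apply, Fin.sum_univ_two],
      by ext i j; fin_cases i <;> fin_cases j <;> simp [Matrix.mul_apply, Fin.sum_univ_two]⟩, rfl⟩

/-- The lower elementary unipotent `(1 0; 1 1) ∈ GL₂(𝔽_p)`. [folklore] -/
theorem exists_lower : ∃ L : GL (Fin 2) (ZMod p), (L : Matrix (Fin 2) (Fin 2) (ZMod p)) = !![1, 0; 1, 1] :=
  ⟨⟨!![1, 0; 1, 1], !![1, 0; -1, 1],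
      by ext i j; fin_cases i <;> fin_cases j <;> simp [Matrix.mul_apply, Fin.sum_univ_two],
      by ext i j; fin_cases i <;> fin_cases j <;> simp [Matrix.mul_apply, Fin.sum_univ_two]⟩, rfl⟩

/-- Powers of the upper unipotent: `(1 1; 0 1)^k = (1 k; 0 1)`. [folklore] -/
theorem upper_pow (k : ℕ) :
    (!![1, 1; 0, 1] : Matrix (Fin 2) (Fin 2) (ZMod p)) ^ k = !![1, (k : ZMod p); 0, 1] := by
  induction k with
  | zero => ext i j; fin_cases i <;> fin_cases j <;> simp
  | succ k ih =>
    rw [pow_succ, ih]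
    ext i j; fin_cases i <;> fin_cases j <;> simp [Matrix.mul_apply, Fin.sum_univ_two, add_comm]

/-- Powers of the lower unipotent: `(1 0; 1 1)^k = (1 0; k 1)`. [folklore] -/
theorem lower_pow (k : ℕ) :
    (!![1, 0; 1, 1] : Matrix (Fin 2) (Fin 2) (ZMod p)) ^ k = !![1, 0; (k : ZMod p), 1] := by
  induction k with
  | zero => ext i j; fin_cases i <;> fin_cases j <;> simp
  | succ k ih =>
    rw [pow_succ, ih]
    ext i j; fin_cases i <;> fin_cases j <;> simp [Matrix.mul_apply, Fin.sum_univ_two]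

end Surj

/-! ## §3. (sur) and `[M:ℚ] < p` ⟹ `ρ̄|_{Γ_M}` absolutely irreducible -/

section BaseChange

variable (W : WeierstrassCurve ℚ) [W.IsElliptic] (p : ℕ) [Fact p.Prime]

omit [W.IsElliptic] in
/-- **(sur) over `ℚ` and `[M:ℚ] < p` ⟹ `ρ̄|_{Γ_M}` absolutely irreducible** (for a framing over `ℚ`).
Pigeonhole: for `σ` with `ρ̄(σ) = (1 1; 0 1)` some `σ^k` with `1 ≤ k ≤ [M:ℚ] < p` lies in `Γ_M`, and
`ρ̄(σ^k) = (1 k; 0 1)` is a transvection fixing `⟨e₁⟩` only; likewise a lower one fixing `⟨e₂⟩` only.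
[folklore] -/
theorem isAbsolutelyIrreducible_comp_of_surj_of_finrank_lt (hsurj : W.HasSurjectiveModNGaloisRep (p : ℤ))
    {ρ : ModPGaloisRep ℚ (ZMod p) 2} (hρ : W.IsTorsionGaloisRep p ρ)
    (M : Type) [Field M] [NumberField M] (hM : Module.finrank ℚ M < p) :
    FramedRep.IsAbsolutelyIrreducible (ρ.comp (absGaloisRestrict ℚ M)) := by
  have hp : p.Prime := Fact.out
  obtain ⟨U, hU⟩ := exists_upper p
  obtain ⟨L, hL⟩ := exists_lower p
  obtain ⟨σ, hσ⟩ := exists_eq_of_surj W p hsurj hρ U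
  obtain ⟨σ', hσ'⟩ := exists_eq_of_surj W p hsurj hρ L
  -- the image of `Γ_M` has index `[M:ℚ]`
  set Γ : Subgroup (absoluteGaloisGroup ℚ) := (absGaloisRestrict ℚ M).toMonoidHom.range with hΓ
  have hindex : Γ.index = Module.finrank ℚ M :=
    (Literature.NumberTheory.Automorphic.isOpen_range_absGaloisRestrict_and_index ℚ M).2
  have hindex0 : Γ.index ≠ 0 := by rw [hindex]; exact Module.finrank_pos.ne'
  -- pigeonhole on cosets
  obtain ⟨k, hk0, hkle, hk⟩ := Γ.exists_pow_mem_of_index_ne_zero hindex0 σ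
  obtain ⟨k', hk0', hkle', hk'⟩ := Γ.exists_pow_mem_of_index_ne_zero hindex0 σ'
  obtain ⟨g, hg⟩ := hk
  obtain ⟨g', hg'⟩ := hk'
  have hkp : (k : ZMod p) ≠ 0 := by
    rw [Ne, ZMod.natCast_eq_zero_iff]
    exact fun h ↦ absurd (Nat.le_of_dvd hk0 h) (by omega)
  have hkp' : (k' : ZMod p) ≠ 0 := by
    rw [Ne, ZMod.natCast_eq_zero_iff]
    exact fun h ↦ absurd (Nat.le_of_dvd hk0' h) (by omega)
  -- the two transvections in the image of `Γ_M`
  have h1 : (((ρ.comp (absGaloisRestrict ℚ M)) g : GL (Fin 2) (ZMod p)) : Matrix (Fin 2) (Fin 2) (ZMod p)) =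
      !![1, (k : ZMod p); 0, 1] := by
    have hcomp : (ρ.comp (absGaloisRestrict ℚ M)) g = ρ σ ^ k := by
      rw [← map_pow, ← hg]; rfl
    rw [hcomp, Units.val_pow_eq_pow_val, hσ, hU, upper_pow]
  have h2 : (((ρ.comp (absGaloisRestrict ℚ M)) g' : GL (Fin 2) (ZMod p)) : Matrix (Fin 2) (Fin 2) (ZMod p)) =
      !![1, 0; (k' : ZMod p), 1] := by
    have hcomp : (ρ.comp (absGaloisRestrict ℚ M)) g' = ρ σ' ^ k' := by
      rw [← map_pow, ← hg']; rfl
    rw [hcomp, Units.val_pow_eq_pow_val, hσ', hL, lower_pow]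
  refine isAbsolutelyIrreducible_of_transvections _ g g' ?_ ?_ ?_ ?_ ![1, 0] ?_ ?_
  · rw [h1]; intro h
    have h01 := congrFun (congrFun h 0) 1
    simp at h01
    exact hkp h01
  · rw [h1]; ext i j; fin_cases i <;> fin_cases j <;> simp [Matrix.mul_apply, Fin.sum_univ_two]
  · rw [h2]; intro h
    have h10 := congrFun (congrFun h 1) 0
    simp at h10
    exact hkp' h10
  · rw [h2]; ext i j; fin_cases i <;> fin_cases j <;> simp [Matrix.mul_apply, Fin.sum_univ_two]
  · rw [h1]; ext i; fin_cases i <;> simp [Matrix.mulVec, dotProduct, Fin.sum_univ_two]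
  · rw [h2]; intro h
    have h1' := congrFun h 1
    simp [Matrix.mulVec, dotProduct, Fin.sum_univ_two] at h1'
    exact hkp' h1'

/-- **(sur) and `[M:ℚ] < p` ⟹ (irr_M), framed.** For `E/ℚ` with `ρ̄_{E,p}` onto `GL₂(𝔽_p)` and a
number field `M` with `[M:ℚ] < p`, EVERY `𝔽_p`-framing of `E_M[p] = E[p]|_{Γ_M}` is absolutely
irreducible. [folklore] -/
theorem irrM_framed_of_surj (hsurj : W.HasSurjectiveModNGaloisRep (p : ℤ))
    (M : Type) [Field M] [NumberField M] (hM : Module.finrank ℚ M < p)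
    (ρ : ModPGaloisRep M (ZMod p) 2) (hρ : (W.baseChange M).IsTorsionGaloisRep p ρ) :
    FramedRep.IsAbsolutelyIrreducible ρ := by
  have hp : p.Prime := Fact.out
  haveI : NeZero ((p : ℕ) : ℚ) := ⟨by exact_mod_cast hp.ne_zero⟩
  obtain ⟨ρ₀, hρ₀⟩ := W.exists_isTorsionGaloisRep p
  have habs := isAbsolutelyIrreducible_comp_of_surj_of_finrank_lt W p hsurj hρ₀ M hM
  have hρ₁ := isTorsionGaloisRep_baseChange_comp W p hρ₀ M
  obtain ⟨P, hP⟩ := hρ₁.exists_conj hρ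
  rw [FramedRep.isAbsolutelyIrreducible_iff_coe] at habs ⊢
  exact IsAbsIrreducible.of_conj _ _ P (fun γ ↦ hP γ) habs

/-- **(L1) `BigImageSmallBaseChange`** (planner memo K1PRIME-LINE-MEMO-v1 §5, `Sketch7.lean`, verbatim):
for `p ≥ 5` and `ρ̄_{E,p}` surjective, every number field `M` with `[M:ℚ] ≤ 4` — in particular the
imaginary quadratic `K`, the real quadratic `F = ℚ(√d)` and the CM biquadratic `M = F·K` of the
base-change line — has `E[p]|_{Γ_M}` absolutely irreducible in every framing: BCS25 Prop. 5.2.1 (iv)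
(irr_M) and (irr_K) for the frames of K1′ with no Chebotarev choice. [folklore] -/
theorem bigImageSmallBaseChange :
    ∀ (W : WeierstrassCurve ℚ) [W.IsElliptic] (p : ℕ) [Fact p.Prime], 5 ≤ p →
      Literature.NumberTheory.EllipticCurves.Rank1Residual.Surj W p →
      ∀ (M : Type) [Field M] [NumberField M], Module.finrank ℚ M ≤ 4 →
        ∀ ρ : ModPGaloisRep M (ZMod p) 2, (W.baseChange M).IsTorsionGaloisRep p ρ →
          FramedRep.IsAbsolutelyIrreducible ρ :=
  fun W _ p _ hp hs M _ _ hM ρ hρ ↦ irrM_framed_of_surj W p hs M (by omega) ρ hρ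

end BaseChange

end Summit.BirchSwinnertonDyer.BirchSwinnertonDyer.Theorems.SignedBaseChangeK1BigImage

end
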